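import Literature.Probability.FitznerVanDerHofstad2017.MeanFieldD11Stage1EvalRec
import HarnessLib

/-!
# FitznerVanDerHofstad2017.Stage1OpenBranchD11 — which branch of the open repulsive-polygon cells the typed `d = 11` record takes (kernel)

LANDING MODULE (b2b-lace, LEAN TYPING SEAT 2, gen 13; fourth module of the gen). ADDITIVE: nothing in
`Stage1Cells*`, `Stage1Eval*`, `MeanFieldD11Cert` (rev 6), `MeanFieldD11Inputs`, `NobleInstantiate`, `NobleAssumptions`
is touched.

WHAT. The typed notebook cells `Stage1Cells.openBubble / openTriangle / openSquare P m k` (Percolation.nb cell 12,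
verbatim transcription) have the shape `Min[K-branch, extraction branch]`.
* §1 (generic in the parameters `P`) NAMES the two branches — `openBubbleK/E`, `openTriangleK/E`, `openSquareK/E` — with
  the definitional splits `openBubble_eq : openBubble P m k = min (openBubbleK P m k) (openBubbleE P m k) := rfl` (etc.),
  and the ADDITIVE extraction variants `openTriangleEplus / openSquareEplus`: the raw notebook carries a `*` token between
  the explicit `Max[…]` and the first remainder term of the open triangle / square (DIVERGENCE D12); `…Eplus` is the same
  expression with that token read as `+` (the engines' `corrected-open-polygons` variant; the additive form of
  [FvdH17-II] §4).  It also records `DataQ.ev_min / ev_max` (the ℚ mirror commutes with `Min`/`Max`, `rfl`).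
* §2 DECIDES IN THE KERNEL (`decide +kernel` over the generic ℚ mirror `Stage1Cells.DataQ.ev` of `Stage1Eval`), at the
  certified `d = 11` record data — tables `CertD11.dataHi`, parameters `CertD11.P = ⟨11, 12, 28⟩`, the O12g state of
  record `CertD11Rec.stateRec`, BOTH points `s = i, o` — and for EVERY open-cell instance the Stage-1 table uses
  (`openBubble (m,k) ∈ {(1,0),(2,0),(2,1)}`, `openTriangle (m,k) ∈ {(2,0),(3,0),(3,1),(4,0)}`, `openSquare (3,0)`;
  these are all call sites of `Stage1Cells` / `Stage1Cells.Rec`, the parametrised `HdashA2 P 1`, `HdashN P 1|2`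
  included) WHICH branch is the minimum:
  (a) AS CODED: `openBubble` (all three instances) and `openTriangle (2,0), (3,0), (3,1)` take the EXTRACTION branch
      (`E < K`, strict); `openTriangle (4,0)` and `openSquare (3,0)` take the K-branch (`K ≤ E`);
  (b) with the ADDITIVE extraction variant the K-branch is the minimum for EVERY open triangle / square instance
      (`K ≤ E⁺`);
  (c) pattern (a) holds verbatim at the earlier certified state `CertD11.state` as well.
* §3 COROLLARIES: the record values `dataHi.ev P s stateRec (openTriangle P m k)` ARE the extraction-branch values for
  `(m,k) = (2,0), (3,0), (3,1)` and the K-branch value for `(4,0)`; `openSquare (3,0)` is its K-branch; the three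
  `openBubble` instances are their extraction branches.

WHY (LEMMAS §21 node N72(b); GAPS 'lean2 gen 13 — AMENDMENT 2').  The (S2a′) hypotheses of
`D11.meanField_d11_typedStage1` / `D11.meanField_full_d11_typedStage1` name the typed Stage-1 record AS CODED.  This
module locates, in the kernel, the OPEN-CELL part of the difference between the coded recipe and the additive /
raised-multiplicity recipe at the record: as coded, the D12 product branch is the SELECTED minimum at `openTriangle`
`m = 2, 3` (so, as coded, the open-cell multiplicities of DIVERGENCE D26 / LEMMAS §21 are value-relevant exactly there),
whereas under the additive reading the K-branch — which carries no multiplicity — is selected at every open triangle /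
square instance, so that every open-cell multiplicity RAISE is value-neutral at the record once the token is read
additively (raising a losing branch).  For the twin of N72(b) this means: in the open cells only the additive open
triangle matters (its record value is then its K-branch, an INCREASE over the coded value at `m = 2, 3`); the closed
Triangle one-tail / Square two-tail multiplicities remain the substantive part.  This is the typed-cell counterpart of the
referee's reading (R243 / R249) of engine B's record run, where the stored open cells equal their K-branches.

EPISTEMIC STATUS.  Kernel facts about the typed transcription evaluated at typed rational data (`#print axioms`:
`propext`, `Classical.choice`, `Quot.sound`).  No bound on any lattice quantity is asserted, and which reading of the
notebook token is the intended one is DIVERGENCE D12's question, not decided here.  No dimension sentence of the packet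
is touched (VERDICT-D10 NO; `MeanFieldD11Cert` rev 6 is the record).

[cite: FitznerVanDerHofstad2017, notebook Percolation.nb cell 12 (transcript l.419–461): `Bound[OpenBubble|OpenTriangle|OpenSquare,m,s]`]
-/


namespace Literature.Probability.FitznerVanDerHofstad2017
namespace Stage1Cells

open NoGoFrame PX

/-! ## §1 The two branches of the open cells (generic) -/

section branches

variable (P : Params)

/-- K-branch of cell 12's `Bound[OpenBubble,m,s]/(2dz)^k`: `(2dz)^{m−k} VarGamma2² K[2,m,{1}]`. [folklore] -/
def openBubbleK (m k : ℕ) : T := w P ^ (m - k) * Vg ^ 2 * tab (.K 2 m .v1)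

/-- extraction branch of cell 12's `Bound[OpenBubble,m,s]/(2dz)^k` (explicit `Max[…]` PLUS the two remainders, as coded).
[folklore] -/
def openBubbleE (m k : ℕ) : T :=
  max (sumR m P.CS fun j => C (j + 1 - m) * zsh P j k * tab (.baw j .v2))
      (sumR m P.CS fun j => C (j + 1 - m) * zsh P j k * tab (.baw j .v1))
    + C (P.CS + 1 - m) * w P ^ (P.CS + 1 - k) * tab (.K 1 (P.CS + 1) .v1)
    + w P ^ (P.CS + 1 - k) * Vg ^ 2 * tab (.K 2 (P.CS + 1) .v1)

/-- `openBubble = Min[K-branch, extraction branch]`, definitionally. [folklore] -/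
theorem openBubble_eq (m k : ℕ) : openBubble P m k = min (openBubbleK P m k) (openBubbleE P m k) := rfl

/-- K-branch of cell 12's `Bound[OpenTriangle,m,s]/(2dz)^k`: `(2dz)^{m−k} VarGamma2³ K[3,m,{1}]`. [folklore] -/
def openTriangleK (m k : ℕ) : T := w P ^ (m - k) * Vg ^ 3 * tab (.K 3 m .v1)

/-- extraction branch of cell 12's `Bound[OpenTriangle,m,s]/(2dz)^k` AS CODED: the explicit `Max[…]` MULTIPLIES the first
remainder term (DIVERGENCE D12: the raw notebook's `*` token). [folklore] -/
def openTriangleE (m k : ℕ) : T :=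
  max (sumR m P.CS fun j => C (j + 1 - m) * C (j + 2 - m) * z ^ j * tab (.baw j .v2) /ₙ 2)
      (sumR m P.CS fun j => C (j + 1 - m) * C (j + 2 - m) * z ^ j * tab (.baw j .v1) /ₙ 2)
      * C (P.CS + 1 - m) * C (P.CS - m) * w P ^ (P.CS + 1 - k) * Vg * tab (.K 1 (P.CS + 1) .v1) /ₙ 2
    + C (P.CS + 1 - m) * w P ^ (P.CS + 1 - k) * Vg ^ 2 * tab (.K 2 (P.CS + 1) .v1)
    + w P ^ (P.CS + 1 - k) * Vg ^ 3 * tab (.K 3 (P.CS + 1) .v1)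

/-- `openTriangle = Min[K-branch, extraction branch]`, definitionally. [folklore] -/
theorem openTriangle_eq (m k : ℕ) : openTriangle P m k = min (openTriangleK P m k) (openTriangleE P m k) := rfl

/-- the ADDITIVE extraction variant of the open triangle: the same expression with D12's `*` token read as `+` (the
engines' `corrected-open-polygons` variant). [folklore] -/
def openTriangleEplus (m k : ℕ) : T :=
  max (sumR m P.CS fun j => C (j + 1 - m) * C (j + 2 - m) * z ^ j * tab (.baw j .v2) /ₙ 2)
      (sumR m P.CS fun j => C (j + 1 - m) * C (j + 2 - m) * z ^ j * tab (.baw j .v1) /ₙ 2)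
    + C (P.CS + 1 - m) * C (P.CS - m) * w P ^ (P.CS + 1 - k) * Vg * tab (.K 1 (P.CS + 1) .v1) /ₙ 2
    + C (P.CS + 1 - m) * w P ^ (P.CS + 1 - k) * Vg ^ 2 * tab (.K 2 (P.CS + 1) .v1)
    + w P ^ (P.CS + 1 - k) * Vg ^ 3 * tab (.K 3 (P.CS + 1) .v1)

/-- K-branch of cell 12's `Bound[OpenSquare,m,s]/(2dz)^k`: `(2dz)^{m−k} VarGamma2⁴ K[4,m,{1}]`. [folklore] -/
def openSquareK (m k : ℕ) : T := w P ^ (m - k) * Vg ^ 4 * tab (.K 4 m .v1)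

/-- extraction branch of cell 12's `Bound[OpenSquare,m,s]/(2dz)^k` AS CODED (D12 product; D26 literal `10`s). [folklore] -/
def openSquareE (m k : ℕ) : T :=
  max (sumR m P.CS fun j => C (j + 1 - m) * C (j + 2 - m) * C (j + 3 - m) * z ^ j * tab (.baw j .v2) /ₙ 6)
      (sumR m P.CS fun j => C (j + 1 - m) * C (j + 2 - m) * C (j + 3 - m) * z ^ j * tab (.baw j .v1) /ₙ 6)
      * C (10 + 1 - m) * C (10 + 2 - m) * C (10 + 3 - m) * w P ^ (P.CS + 1 - k) * Vg * tab (.K 1 (P.CS + 1) .v1) /ₙ 6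
    + C (10 - m) * C (10 - 1 - m) * w P ^ (P.CS + 1 - k) * Vg ^ 2 * tab (.K 2 (P.CS + 1) .v1) /ₙ 2
    + C (10 - m) * w P ^ (P.CS + 1 - k) * Vg ^ 3 * tab (.K 3 (P.CS + 1) .v1)
    + w P ^ (P.CS + 1 - k) * Vg ^ 4 * tab (.K 4 (P.CS + 1) .v1)

/-- `openSquare = Min[K-branch, extraction branch]`, definitionally. [folklore] -/
theorem openSquare_eq (m k : ℕ) : openSquare P m k = min (openSquareK P m k) (openSquareE P m k) := rfl

/-- the ADDITIVE extraction variant of the open square (D12's `*` token read as `+`; the literal `10`s kept). [folklore] -/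
def openSquareEplus (m k : ℕ) : T :=
  max (sumR m P.CS fun j => C (j + 1 - m) * C (j + 2 - m) * C (j + 3 - m) * z ^ j * tab (.baw j .v2) /ₙ 6)
      (sumR m P.CS fun j => C (j + 1 - m) * C (j + 2 - m) * C (j + 3 - m) * z ^ j * tab (.baw j .v1) /ₙ 6)
    + C (10 + 1 - m) * C (10 + 2 - m) * C (10 + 3 - m) * w P ^ (P.CS + 1 - k) * Vg * tab (.K 1 (P.CS + 1) .v1) /ₙ 6
    + C (10 - m) * C (10 - 1 - m) * w P ^ (P.CS + 1 - k) * Vg ^ 2 * tab (.K 2 (P.CS + 1) .v1) /ₙ 2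
    + C (10 - m) * w P ^ (P.CS + 1 - k) * Vg ^ 3 * tab (.K 3 (P.CS + 1) .v1)
    + w P ^ (P.CS + 1 - k) * Vg ^ 4 * tab (.K 4 (P.CS + 1) .v1)

end branches

namespace DataQ

variable (E : DataQ) (P : Params) (s : Pt) (y : StateQ)

/-- the ℚ mirror commutes with `Min`. [folklore] -/
theorem ev_min (a b : T) : E.ev P s y (min a b) = min (E.ev P s y a) (E.ev P s y b) := rfl

/-- the ℚ mirror commutes with `Max`. [folklore] -/
theorem ev_max (a b : T) : E.ev P s y (max a b) = max (E.ev P s y a) (E.ev P s y b) := rfl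

end DataQ

/-! ## §2 Which branch is the minimum at the certified `d = 11` record (kernel) -/

namespace CertD11Rec

open CertD11 (P dataHi state)

set_option maxHeartbeats 4000000 in
/-- AS CODED, at the record `(dataHi, P, stateRec)`, point `s`: the three open-bubble instances of the Stage-1 table take
their EXTRACTION branch, strictly. [folklore] -/
theorem openBubble_branch_rec (s : Pt) :
    dataHi.ev P s stateRec (openBubbleE P 1 0) < dataHi.ev P s stateRec (openBubbleK P 1 0) ∧
    dataHi.ev P s stateRec (openBubbleE P 2 0) < dataHi.ev P s stateRec (openBubbleK P 2 0) ∧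
    dataHi.ev P s stateRec (openBubbleE P 2 1) < dataHi.ev P s stateRec (openBubbleK P 2 1) := by
  cases s <;> refine ⟨?_, ?_, ?_⟩ <;> decide +kernel

set_option maxHeartbeats 4000000 in
/-- AS CODED, at the record `(dataHi, P, stateRec)`, point `s`: `openTriangle (2,0), (3,0), (3,1)` take their EXTRACTION
(D12 product) branch, strictly; `openTriangle (4,0)` takes its K-branch. [folklore] -/
theorem openTriangle_branch_rec (s : Pt) :
    dataHi.ev P s stateRec (openTriangleE P 2 0) < dataHi.ev P s stateRec (openTriangleK P 2 0) ∧
    dataHi.ev P s stateRec (openTriangleE P 3 0) < dataHi.ev P s stateRec (openTriangleK P 3 0) ∧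
    dataHi.ev P s stateRec (openTriangleE P 3 1) < dataHi.ev P s stateRec (openTriangleK P 3 1) ∧
    dataHi.ev P s stateRec (openTriangleK P 4 0) ≤ dataHi.ev P s stateRec (openTriangleE P 4 0) := by
  cases s <;> refine ⟨?_, ?_, ?_, ?_⟩ <;> decide +kernel

set_option maxHeartbeats 4000000 in
/-- AS CODED, at the record `(dataHi, P, stateRec)`, point `s`: `openSquare (3,0)` takes its K-branch. [folklore] -/
theorem openSquare_branch_rec (s : Pt) :
    dataHi.ev P s stateRec (openSquareK P 3 0) ≤ dataHi.ev P s stateRec (openSquareE P 3 0) := by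
  cases s <;> decide +kernel

set_option maxHeartbeats 4000000 in
/-- ADDITIVE VARIANT, at the record `(dataHi, P, stateRec)`, point `s`: against the additive extraction branch the K-branch
is the minimum for EVERY open-triangle instance of the table. [folklore] -/
theorem openTriangle_branch_rec_plus (s : Pt) :
    dataHi.ev P s stateRec (openTriangleK P 2 0) ≤ dataHi.ev P s stateRec (openTriangleEplus P 2 0) ∧
    dataHi.ev P s stateRec (openTriangleK P 3 0) ≤ dataHi.ev P s stateRec (openTriangleEplus P 3 0) ∧
    dataHi.ev P s stateRec (openTriangleK P 3 1) ≤ dataHi.ev P s stateRec (openTriangleEplus P 3 1) ∧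
    dataHi.ev P s stateRec (openTriangleK P 4 0) ≤ dataHi.ev P s stateRec (openTriangleEplus P 4 0) := by
  cases s <;> refine ⟨?_, ?_, ?_, ?_⟩ <;> decide +kernel

set_option maxHeartbeats 4000000 in
/-- ADDITIVE VARIANT, at the record `(dataHi, P, stateRec)`, point `s`: `openSquare (3,0)`'s K-branch is below the
additive extraction branch too. [folklore] -/
theorem openSquare_branch_rec_plus (s : Pt) :
    dataHi.ev P s stateRec (openSquareK P 3 0) ≤ dataHi.ev P s stateRec (openSquareEplus P 3 0) := by
  cases s <;> decide +kernel

set_option maxHeartbeats 4000000 in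
/-- pattern (a) at the EARLIER certified state `CertD11.state` (of `MeanFieldD11Stage1Eval`), point `s`: the same
branches are selected. [folklore] -/
theorem open_branch_state (s : Pt) :
    dataHi.ev P s state (openBubbleE P 1 0) < dataHi.ev P s state (openBubbleK P 1 0) ∧
    dataHi.ev P s state (openBubbleE P 2 0) < dataHi.ev P s state (openBubbleK P 2 0) ∧
    dataHi.ev P s state (openBubbleE P 2 1) < dataHi.ev P s state (openBubbleK P 2 1) ∧
    dataHi.ev P s state (openTriangleE P 2 0) < dataHi.ev P s state (openTriangleK P 2 0) ∧
    dataHi.ev P s state (openTriangleE P 3 0) < dataHi.ev P s state (openTriangleK P 3 0) ∧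
    dataHi.ev P s state (openTriangleE P 3 1) < dataHi.ev P s state (openTriangleK P 3 1) ∧
    dataHi.ev P s state (openTriangleK P 4 0) ≤ dataHi.ev P s state (openTriangleE P 4 0) ∧
    dataHi.ev P s state (openSquareK P 3 0) ≤ dataHi.ev P s state (openSquareE P 3 0) := by
  cases s <;> refine ⟨?_, ?_, ?_, ?_, ?_, ?_, ?_, ?_⟩ <;> decide +kernel

/-! ## §3 The record values of the open cells -/

/-- at the record, point `s`: the open-triangle cells of the table evaluate to their EXTRACTION branch for
`(m,k) = (2,0), (3,0), (3,1)` and to their K-branch for `(4,0)`. [folklore] -/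
theorem ev_openTriangle_rec (s : Pt) :
    dataHi.ev P s stateRec (openTriangle P 2 0) = dataHi.ev P s stateRec (openTriangleE P 2 0) ∧
    dataHi.ev P s stateRec (openTriangle P 3 0) = dataHi.ev P s stateRec (openTriangleE P 3 0) ∧
    dataHi.ev P s stateRec (openTriangle P 3 1) = dataHi.ev P s stateRec (openTriangleE P 3 1) ∧
    dataHi.ev P s stateRec (openTriangle P 4 0) = dataHi.ev P s stateRec (openTriangleK P 4 0) := by
  obtain ⟨h20, h30, h31, h40⟩ := openTriangle_branch_rec s
  simp only [openTriangle_eq, DataQ.ev_min]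
  exact ⟨min_eq_right h20.le, min_eq_right h30.le, min_eq_right h31.le, min_eq_left h40⟩

/-- at the record, point `s`: the open-square cell `(3,0)` evaluates to its K-branch. [folklore] -/
theorem ev_openSquare_rec (s : Pt) :
    dataHi.ev P s stateRec (openSquare P 3 0) = dataHi.ev P s stateRec (openSquareK P 3 0) := by
  simp only [openSquare_eq, DataQ.ev_min]
  exact min_eq_left (openSquare_branch_rec s)

/-- at the record, point `s`: the three open-bubble instances evaluate to their EXTRACTION branch. [folklore] -/
theorem ev_openBubble_rec (s : Pt) :
    dataHi.ev P s stateRec (openBubble P 1 0) = dataHi.ev P s stateRec (openBubbleE P 1 0) ∧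
    dataHi.ev P s stateRec (openBubble P 2 0) = dataHi.ev P s stateRec (openBubbleE P 2 0) ∧
    dataHi.ev P s stateRec (openBubble P 2 1) = dataHi.ev P s stateRec (openBubbleE P 2 1) := by
  obtain ⟨h10, h20, h21⟩ := openBubble_branch_rec s
  simp only [openBubble_eq, DataQ.ev_min]
  exact ⟨min_eq_right h10.le, min_eq_right h20.le, min_eq_right h21.le⟩

/-- at the record, point `s`: under the ADDITIVE reading every open triangle / square instance of the table would
evaluate to its K-branch (`min K E⁺ = K`). [folklore] -/
theorem ev_open_rec_plus (s : Pt) :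
    dataHi.ev P s stateRec (min (openTriangleK P 2 0) (openTriangleEplus P 2 0)) = dataHi.ev P s stateRec (openTriangleK P 2 0) ∧
    dataHi.ev P s stateRec (min (openTriangleK P 3 0) (openTriangleEplus P 3 0)) = dataHi.ev P s stateRec (openTriangleK P 3 0) ∧
    dataHi.ev P s stateRec (min (openTriangleK P 3 1) (openTriangleEplus P 3 1)) = dataHi.ev P s stateRec (openTriangleK P 3 1) ∧
    dataHi.ev P s stateRec (min (openTriangleK P 4 0) (openTriangleEplus P 4 0)) = dataHi.ev P s stateRec (openTriangleK P 4 0) ∧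
    dataHi.ev P s stateRec (min (openSquareK P 3 0) (openSquareEplus P 3 0)) = dataHi.ev P s stateRec (openSquareK P 3 0) := by
  obtain ⟨h20, h30, h31, h40⟩ := openTriangle_branch_rec_plus s
  simp only [DataQ.ev_min]
  exact ⟨min_eq_left h20, min_eq_left h30, min_eq_left h31, min_eq_left h40, min_eq_left (openSquare_branch_rec_plus s)⟩

end CertD11Rec

end Stage1Cells
end Literature.Probability.FitznerVanDerHofstad2017
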